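import Summits.QuantumFields.BalabanUV.T4Continuum.Support.SmoothRefineNeutral
import HarnessLib

/-!
# T⁴ programme, node NE3 — the kinematic refinement lemma, abelian line, file 6: TRANSLATED-SQUARE SUMS AND THE FINE
# FLUX COCHAIN OF THE REFINEMENT (`SmoothRefineSquares`)

Cell `pub-balaban`, NE3 formalisation swarm (`t4/formal/NE3/LEAVES.md` row S4b, unit
`b2b-balaban-t4-ne3-formalise-leaf-10`); sequel of `SmoothRefineNeutral`.  LATTICE CALCULUS (values in a normed
`ℂ`-algebra `𝔸`; no configuration, no estimate of the programme).  The coarse plaquette `(z; μ, ν)` of the contour averages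
of a fine cochain is the block average over the offsets `r ∈ [0,L)^d` of the circulations around the TRANSLATED SQUARES
`(P)_{Lz+r}` (`SmoothRefineNeutral.dC_Tcoarse`, B7 (48)); for the Whitney potential of a closed coarse 2-cochain `F` these
circulations are `Σ_{square} (whitney F − cornerPull F)` (`SmoothRefineWhitney.dC_whitneyPot`).  Here:

§1 block coordinates along the square: `blk`/`res` of `Lz + r + i e_μ + j e_ν` (`i, j < L`);
§2 EXACTLY ONE fine plaquette of each translated square is a corner plaquette, and it lies in block `z`:
`Σ_{i,j<L} cornerPull F (Lz + r + i e_μ + j e_ν) = F(z; μ, ν)`;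
§3 the Whitney values on the square are within `d·δ/L²` of `F(z)/L²` (`δ` = a bound on the coarse differences of `F`), so
`‖Σ_{i,j<L} whitney F (…) − F(z; μ, ν)‖ ≤ d·δ`, hence **`‖dC (Tcoarse (whitneyPot F)) (z; μ, ν)‖ ≤ d·δ`**: the contour
averages of the Whitney potential have a coarse CURL of the size of ONE coarse flux difference (no `L`, no `F` itself) —
the first-order phase mismatch of the refinement is a coarse GRADIENT up to `O(∇F)`;
§4 THE FINE FLUX COCHAIN of the refinement `slicePull U · exp(neutralize (whitneyPot F))` at the cochain level:
`cornerPull F + dC (neutralize (whitneyPot F)) = whitney F − cornerPull (dC (Tcoarse (whitneyPot F)))` =: `fineFlux L F`, with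
the pointwise bounds `‖fineFlux‖ ≤ M/L² + d·δ` and `‖∇ fineFlux‖ ≤ δ/L² + 2d·δ` (`M` a bound on `F`).

HONEST FRAMING: finite-`T⁴` kinematics of block averaging (rung (B)+1 — NOT infinite volume, NOT a mass gap, NOT Clay); no
estimate of the programme, nothing of NE3 claimed; no `BetaPertH`, no (B), no G-an2-4.  PLACEMENT (human rule 2026-08-19):
our work, under `Summits/QuantumFields/BalabanUV/`.
-/

set_option autoImplicit false

open scoped BigOperators

namespace Summit.QuantumFields.BalabanUV.T4Continuum.SmoothRefineSquares

open Literature.MathematicalPhysics.QuantumFieldTheory.Balaban1983to89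
open B7Prop1Explicit SmoothRefineBlocks SmoothRefineSlices SmoothRefineInterp SmoothRefineWhitney SmoothRefineNeutral

noncomputable section

variable {d : ℕ}


/-! ## §1 Block coordinates along a translated square -/

/-- `t < L` unit steps in direction `κ` in block coordinates: the block advances by `e_κ` iff the offset wraps. [folklore] -/
theorem blk_res_add_nat {L : ℕ} (hL : 1 ≤ L) (y : Site d) (κ : Fin d) {t : ℕ} (ht : t < L) :
    blk L (y + (t : ℤ) • e κ) = blk L y + (if res L y κ + t < L then 0 else e κ) ∧
      res L (y + (t : ℤ) • e κ) =
        res L y + (t : ℤ) • e κ - (if res L y κ + t < L then 0 else (L : ℤ) • e κ) := by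
  have h0 := res_nonneg hL y
  have h1 := res_lt hL y
  by_cases h : res L y κ + t < L
  · simp only [h, ↓reduceIte, add_zero, sub_zero]
    refine blk_res_eq_of hL (by rw [← add_assoc, blk_add_res]) (fun i => ?_) (fun i => ?_)
    · simp only [Pi.add_apply, Pi.smul_apply, smul_eq_mul, e_apply]
      split_ifs <;> nlinarith [h0 i]
    · simp only [Pi.add_apply, Pi.smul_apply, smul_eq_mul, e_apply]
      split_ifs with hi
      · subst hi; simpa using h
      · simpa using h1 i
  · simp only [h, ↓reduceIte]
    refine blk_res_eq_of hL ?_ (fun i => ?_) (fun i => ?_)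
    · rw [smul_add, show (L : ℤ) • blk L y + (L : ℤ) • e κ + (res L y + (t : ℤ) • e κ - (L : ℤ) • e κ)
        = ((L : ℤ) • blk L y + res L y) + (t : ℤ) • e κ by abel, blk_add_res]
    · simp only [Pi.add_apply, Pi.sub_apply, Pi.smul_apply, smul_eq_mul, e_apply]
      split_ifs with hi
      · subst hi; have h' := not_lt.1 h; nlinarith [h']
      · simpa using h0 i
    · simp only [Pi.add_apply, Pi.sub_apply, Pi.smul_apply, smul_eq_mul, e_apply]
      split_ifs with hi
      · subst hi
        have := h1 i
        have ht' : (t : ℤ) < L := by exact_mod_cast ht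
        linarith
      · simpa using h1 i

/-- The point `Lz + r + i e_μ + j e_ν` of the translated square `(P)_{Lz+r}` in the plane `(μ, ν)`. [folklore] -/
def sqPt (L : ℕ) (z : Site d) (r : Fin d → Fin L) (μ ν : Fin d) (i j : ℕ) : Site d :=
  (L : ℤ) • z + boxVec L r + (i : ℤ) • e μ + (j : ℤ) • e ν

/-- Block coordinates of the square point (`μ ≠ ν`, `i, j < L`): the offsets in the directions `μ`, `ν` are
`r_μ + i`, `r_ν + j` reduced mod `L`, the block is `z` shifted by `e_μ` ∕ `e_ν` exactly when they wrap. [folklore] -/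
theorem blk_res_sqPt {L : ℕ} (hL : 1 ≤ L) (z : Site d) (r : Fin d → Fin L) {μ ν : Fin d} (hμν : μ ≠ ν) {i j : ℕ}
    (hi : i < L) (hj : j < L) :
    blk L (sqPt L z r μ ν i j) = z + (if (r μ : ℕ) + i < L then 0 else e μ) + (if (r ν : ℕ) + j < L then 0 else e ν) ∧
      res L (sqPt L z r μ ν i j) μ = (if (r μ : ℕ) + i < L then ((r μ : ℕ) : ℤ) + i else ((r μ : ℕ) : ℤ) + i - L) ∧
      res L (sqPt L z r μ ν i j) ν = (if (r ν : ℕ) + j < L then ((r ν : ℕ) : ℤ) + j else ((r ν : ℕ) : ℤ) + j - L) := by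
  have hνμ : ν ≠ μ := fun h => hμν h.symm
  have hcμ : (((r μ : ℕ) : ℤ) + (i : ℤ) < (L : ℤ)) ↔ ((r μ : ℕ) + i < L) := by norm_cast
  have hcν : (((r ν : ℕ) : ℤ) + (j : ℤ) < (L : ℤ)) ↔ ((r ν : ℕ) + j < L) := by norm_cast
  -- first step: `i` units in direction `μ` from the block point
  set y₀ : Site d := (L : ℤ) • z + boxVec L r with hy₀
  have hb₀ : blk L y₀ = z := blk_boxVec hL z r
  have hr₀ : res L y₀ = boxVec L r := res_boxVec hL z r
  have hr₀μ : res L y₀ μ = ((r μ : ℕ) : ℤ) := by rw [hr₀]; rfl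
  have hr₀ν : res L y₀ ν = ((r ν : ℕ) : ℤ) := by rw [hr₀]; rfl
  obtain ⟨hb₁, hr₁⟩ := blk_res_add_nat hL y₀ μ hi
  rw [hb₀, hr₀μ] at hb₁
  rw [hr₀μ] at hr₁
  simp only [hcμ] at hb₁ hr₁
  -- second step: `j` units in direction `ν`
  set y₁ : Site d := y₀ + (i : ℤ) • e μ with hy₁
  have hr₁ν : res L y₁ ν = ((r ν : ℕ) : ℤ) := by
    rw [hr₁]
    simp only [Pi.sub_apply, Pi.add_apply, Pi.smul_apply, smul_eq_mul, e_apply, if_neg hνμ, mul_zero, add_zero,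
      ite_apply, Pi.zero_apply, hr₀ν]
    split_ifs <;> simp
  have hr₁μ : res L y₁ μ = if (r μ : ℕ) + i < L then ((r μ : ℕ) : ℤ) + i else ((r μ : ℕ) : ℤ) + i - L := by
    rw [hr₁]
    simp only [Pi.sub_apply, Pi.add_apply, Pi.smul_apply, smul_eq_mul, e_apply, ↓reduceIte, mul_one, ite_apply,
      Pi.zero_apply, hr₀μ]
    split_ifs <;> simp
  obtain ⟨hb₂, hr₂⟩ := blk_res_add_nat hL y₁ ν hj
  rw [hb₁, hr₁ν] at hb₂
  rw [hr₁ν] at hr₂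
  simp only [hcν] at hb₂ hr₂
  have hpt : sqPt L z r μ ν i j = y₁ + (j : ℤ) • e ν := rfl
  refine ⟨by rw [hpt, hb₂], ?_, ?_⟩
  · rw [hpt, hr₂]
    simp only [Pi.sub_apply, Pi.add_apply, Pi.smul_apply, smul_eq_mul, e_apply, if_neg hμν, mul_zero, add_zero,
      ite_apply, Pi.zero_apply, hr₁μ]
    split_ifs <;> simp
  · rw [hpt, hr₂]
    simp only [Pi.sub_apply, Pi.add_apply, Pi.smul_apply, smul_eq_mul, e_apply, ↓reduceIte, mul_one, ite_apply,
      Pi.zero_apply, hr₁ν]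
    split_ifs <;> simp

/-- The corner condition on the square: the `μ`-offset of the square point is `L − 1` iff `i = L − 1 − r_μ`; likewise for
`ν`, `j`; and then the block is `z`. [folklore] -/
theorem corner_sqPt_iff {L : ℕ} (hL : 1 ≤ L) (z : Site d) (r : Fin d → Fin L) {μ ν : Fin d} (hμν : μ ≠ ν) {i j : ℕ}
    (hi : i < L) (hj : j < L) :
    ((res L (sqPt L z r μ ν i j) μ = (L : ℤ) - 1 ∧ res L (sqPt L z r μ ν i j) ν = (L : ℤ) - 1) ↔
        (i = L - 1 - (r μ : ℕ) ∧ j = L - 1 - (r ν : ℕ))) ∧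
      (i = L - 1 - (r μ : ℕ) → j = L - 1 - (r ν : ℕ) → blk L (sqPt L z r μ ν i j) = z) := by
  obtain ⟨hb, hrμ, hrν⟩ := blk_res_sqPt hL z r hμν hi hj
  have hrμL := (r μ).isLt
  have hrνL := (r ν).isLt
  refine ⟨?_, fun hi' hj' => ?_⟩
  · rw [hrμ, hrν]
    constructor
    · rintro ⟨h1, h2⟩
      constructor
      · split_ifs at h1 <;> omega
      · split_ifs at h2 <;> omega
    · rintro ⟨rfl, rfl⟩
      constructor
      · rw [if_pos (by omega)]; omega
      · rw [if_pos (by omega)]; omega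
  · rw [hb, if_pos (by omega), if_pos (by omega), add_zero, add_zero]

/-! ## §2 The corner pullback sums to the coarse value over every translated square -/

section Sums

variable {X : Type*} [AddCommGroup X] [Module ℝ X]

omit [Module ℝ X] in
/-- **Exactly one corner plaquette per translated square, in block `z`**:
`Σ_{i,j<L} cornerPull F (Lz + r + i e_μ + j e_ν; μ, ν) = F(z; μ, ν)`. [folklore] -/
theorem sum_sq_cornerPull {L : ℕ} (hL : 1 ≤ L) (F : Site d → Fin d → Fin d → X) (z : Site d) (r : Fin d → Fin L)
    {μ ν : Fin d} (hμν : μ ≠ ν) :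
    ∑ i ∈ Finset.range L, ∑ j ∈ Finset.range L, cornerPull L F (sqPt L z r μ ν i j) μ ν = F z μ ν := by
  have hrμL := (r μ).isLt
  have hrνL := (r ν).isLt
  set i₀ := L - 1 - (r μ : ℕ) with hi₀
  set j₀ := L - 1 - (r ν : ℕ) with hj₀
  have hi₀L : i₀ < L := by omega
  have hj₀L : j₀ < L := by omega
  -- the value of the summand
  have hval : ∀ i ∈ Finset.range L, ∀ j ∈ Finset.range L,
      cornerPull L F (sqPt L z r μ ν i j) μ ν = if i = i₀ ∧ j = j₀ then F z μ ν else 0 := by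
    intro i hi j hj
    rw [Finset.mem_range] at hi hj
    obtain ⟨hiff, hblk⟩ := corner_sqPt_iff hL z r hμν hi hj
    unfold cornerPull
    by_cases h : i = i₀ ∧ j = j₀
    · rw [if_pos (hiff.2 h), if_pos h, hblk h.1 h.2]
    · rw [if_neg (fun h' => h (hiff.1 h')), if_neg h]
  rw [Finset.sum_congr rfl fun i hi => Finset.sum_congr rfl fun j hj => hval i hi j hj]
  rw [Finset.sum_eq_single i₀, Finset.sum_eq_single j₀]
  · simp
  · intro j _ hj; simp [hj]
  · intro h; exact absurd (Finset.mem_range.2 hj₀L) h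
  · intro i _ hi
    exact Finset.sum_eq_zero fun j _ => by simp [hi]
  · intro h; exact absurd (Finset.mem_range.2 hi₀L) h

end Sums

/-! ## §3 The Whitney values on a translated square, and the curl of the contour averages -/

section Bounds

variable {X : Type*} [NormedAddCommGroup X] [NormedSpace ℝ X]

/-- On the translated square every Whitney value is within `d·δ/L²` of `F(z)/L²`. [folklore] -/
theorem norm_whitney_sqPt_sub_le {L : ℕ} (hL : 1 ≤ L) (F : Site d → Fin d → Fin d → X) {δ : ℝ} (hδ0 : 0 ≤ δ)
    (hδ : ∀ (x : Site d) (α μ ν : Fin d), ‖F (x + e α) μ ν - F x μ ν‖ ≤ δ) (z : Site d) (r : Fin d → Fin L)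
    {μ ν : Fin d} (hμν : μ ≠ ν) {i j : ℕ} (hi : i < L) (hj : j < L) :
    ‖whitney L F (sqPt L z r μ ν i j) μ ν - (1 / (L : ℝ) ^ 2) • F z μ ν‖ ≤ d * δ / (L : ℝ) ^ 2 := by
  set p := sqPt L z r μ ν i j with hp
  set S : Finset (Fin d) := (Finset.univ.erase μ).erase ν with hS
  have hcard : S.card = d - 2 := by
    rw [hS, Finset.card_erase_of_mem (Finset.mem_erase.2 ⟨fun h => hμν h.symm, Finset.mem_univ ν⟩),
      Finset.card_erase_of_mem (Finset.mem_univ μ), Finset.card_univ, Fintype.card_fin]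
    omega
  have hd2 : 2 ≤ d := by
    have h1 : Fintype.card (Fin d) = d := Fintype.card_fin d
    have : 2 ≤ Fintype.card (Fin d) := by
      rw [← Finset.card_univ, ← Finset.card_pair hμν]
      exact Finset.card_le_card (Finset.subset_univ _)
    omega
  -- interpolation is within `(d-2)δ` of the block value
  have h1 : ‖interp L S (fun x => F x μ ν) p - F (blk L p) μ ν‖ ≤ (d - 2 : ℕ) * δ := by
    rw [← hcard]; exact norm_interp_sub_blk_le hL S _ hδ0 (fun x α => hδ x α μ ν) p
  -- the block of `p` is at most two unit steps from `z`
  have h2 : ‖F (blk L p) μ ν - F z μ ν‖ ≤ 2 * δ := by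
    obtain ⟨hb, -, -⟩ := blk_res_sqPt hL z r hμν hi hj
    rw [hp, hb]
    have step : ∀ (w : Site d) (κ : Fin d) (q : Prop) [Decidable q],
        ‖F (w + if q then 0 else e κ) μ ν - F w μ ν‖ ≤ δ := by
      intro w κ q _
      split_ifs
      · simp [hδ0]
      · exact hδ w κ μ ν
    calc ‖F (z + (if (r μ : ℕ) + i < L then 0 else e μ) + (if (r ν : ℕ) + j < L then 0 else e ν)) μ ν - F z μ ν‖
        ≤ ‖F (z + (if (r μ : ℕ) + i < L then 0 else e μ) + (if (r ν : ℕ) + j < L then 0 else e ν)) μ ν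
            - F (z + (if (r μ : ℕ) + i < L then 0 else e μ)) μ ν‖
          + ‖F (z + (if (r μ : ℕ) + i < L then 0 else e μ)) μ ν - F z μ ν‖ := norm_sub_le_norm_sub_add_norm_sub _ _ _
      _ ≤ δ + δ := add_le_add (step _ ν _) (step _ μ _)
      _ = 2 * δ := by ring
  have h3 : ‖interp L S (fun x => F x μ ν) p - F z μ ν‖ ≤ d * δ := by
    calc ‖interp L S (fun x => F x μ ν) p - F z μ ν‖
        ≤ ‖interp L S (fun x => F x μ ν) p - F (blk L p) μ ν‖ + ‖F (blk L p) μ ν - F z μ ν‖ :=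
          norm_sub_le_norm_sub_add_norm_sub _ _ _
      _ ≤ (d - 2 : ℕ) * δ + 2 * δ := add_le_add h1 h2
      _ = d * δ := by rw [Nat.cast_sub hd2]; push_cast; ring
  rw [whitney, ← hS, ← smul_sub, norm_smul, Real.norm_of_nonneg (by positivity)]
  calc 1 / (L : ℝ) ^ 2 * ‖interp L S (fun x => F x μ ν) p - F z μ ν‖ ≤ 1 / (L : ℝ) ^ 2 * (d * δ) :=
        mul_le_mul_of_nonneg_left h3 (by positivity)
    _ = d * δ / (L : ℝ) ^ 2 := by ring

/-- `‖Σ_{i,j<L} whitney F (…) − F(z; μ, ν)‖ ≤ d·δ`. [folklore] -/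
theorem norm_sum_sq_whitney_sub_le {L : ℕ} (hL : 1 ≤ L) (F : Site d → Fin d → Fin d → X) {δ : ℝ} (hδ0 : 0 ≤ δ)
    (hδ : ∀ (x : Site d) (α μ ν : Fin d), ‖F (x + e α) μ ν - F x μ ν‖ ≤ δ) (z : Site d) (r : Fin d → Fin L)
    {μ ν : Fin d} (hμν : μ ≠ ν) :
    ‖∑ i ∈ Finset.range L, ∑ j ∈ Finset.range L, whitney L F (sqPt L z r μ ν i j) μ ν - F z μ ν‖ ≤ d * δ := by
  have hL0 : (L : ℝ) ≠ 0 := by exact_mod_cast (by omega : L ≠ 0)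
  -- `F z = Σ_{i,j} L⁻² • F z`
  have hconst : ∑ _i ∈ Finset.range L, ∑ _j ∈ Finset.range L, (1 / (L : ℝ) ^ 2) • F z μ ν = F z μ ν := by
    rw [Finset.sum_const, Finset.sum_const, Finset.card_range, ← Nat.cast_smul_eq_nsmul ℝ,
      ← Nat.cast_smul_eq_nsmul ℝ, smul_smul, smul_smul,
      show (L : ℝ) * (L : ℝ) * (1 / (L : ℝ) ^ 2) = 1 by field_simp, one_smul]
  rw [← hconst, ← Finset.sum_sub_distrib]
  simp_rw [← Finset.sum_sub_distrib]
  calc ‖∑ i ∈ Finset.range L, ∑ j ∈ Finset.range L, (whitney L F (sqPt L z r μ ν i j) μ ν - (1 / (L : ℝ) ^ 2) • F z μ ν)‖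
      ≤ ∑ i ∈ Finset.range L, ‖∑ j ∈ Finset.range L, (whitney L F (sqPt L z r μ ν i j) μ ν - (1 / (L : ℝ) ^ 2) • F z μ ν)‖ :=
        norm_sum_le _ _
    _ ≤ ∑ i ∈ Finset.range L, ∑ j ∈ Finset.range L, d * δ / (L : ℝ) ^ 2 :=
        Finset.sum_le_sum fun i hi => (norm_sum_le _ _).trans (Finset.sum_le_sum fun j hj =>
          norm_whitney_sqPt_sub_le hL F hδ0 hδ z r hμν (Finset.mem_range.1 hi) (Finset.mem_range.1 hj))
    _ = d * δ := by
        rw [Finset.sum_const, Finset.sum_const, Finset.card_range, nsmul_eq_mul, nsmul_eq_mul]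
        field_simp

end Bounds

section Curl

variable {𝔸 : Type*} [NormedRing 𝔸] [NormedAlgebra ℂ 𝔸]

/-- **THE CURL OF THE CONTOUR AVERAGES OF THE WHITNEY POTENTIAL IS A FIRST-ORDER QUANTITY**: for a closed antisymmetric
coarse 2-cochain `F` whose coarse differences are bounded by `δ`,
`‖dC (Tcoarse L (whitneyPot L F)) (z; μ, ν)‖ ≤ d·δ` (`μ ≠ ν`). [folklore] -/
theorem norm_dC_Tcoarse_whitneyPot_le {L : ℕ} (hL : 1 ≤ L) {F : Site d → Fin d → Fin d → 𝔸} (ha : Anti2 F)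
    (hc : Closed2 F) {δ : ℝ} (hδ0 : 0 ≤ δ) (hδ : ∀ (x : Site d) (α μ ν : Fin d), ‖F (x + e α) μ ν - F x μ ν‖ ≤ δ)
    (z : Site d) {μ ν : Fin d} (hμν : μ ≠ ν) : ‖dC (Tcoarse L (whitneyPot L F)) z μ ν‖ ≤ d * δ := by
  rw [dC_Tcoarse]
  refine norm_avg_le L hL _ fun r => ?_
  have h : ∑ i ∈ Finset.range L, ∑ j ∈ Finset.range L,
      dC (whitneyPot L F) ((L : ℤ) • z + boxVec L r + (i : ℤ) • e μ + (j : ℤ) • e ν) μ ν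
      = ∑ i ∈ Finset.range L, ∑ j ∈ Finset.range L, whitney L F (sqPt L z r μ ν i j) μ ν - F z μ ν := by
    rw [← sum_sq_cornerPull hL F z r hμν, ← Finset.sum_sub_distrib]
    simp_rw [← Finset.sum_sub_distrib]
    refine Finset.sum_congr rfl fun i _ => Finset.sum_congr rfl fun j _ => ?_
    exact dC_whitneyPot hL ha hc _ hμν
  rw [h]
  exact norm_sum_sq_whitney_sub_le hL F hδ0 hδ z r hμν

end Curl

/-! ## §4 The fine flux cochain of the refinement -/

section Flux

variable {𝔸 : Type*} [NormedRing 𝔸] [NormedAlgebra ℂ 𝔸]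

/-- THE FINE FLUX COCHAIN: `whitney F − cornerPull (dC (Tcoarse (whitneyPot F)))`. [folklore] -/
def fineFlux (L : ℕ) (F : Site d → Fin d → Fin d → 𝔸) (y : Site d) (μ ν : Fin d) : 𝔸 :=
  whitney L F y μ ν - cornerPull L (fun z μ ν => dC (Tcoarse L (whitneyPot L F)) z μ ν) y μ ν

omit [NormedAlgebra ℂ 𝔸] in
/-- `dC` is additive: subtraction. [folklore] -/
theorem dC_sub (a b : Site d → Fin d → 𝔸) (y : Site d) (μ ν : Fin d) :
    dC (fun y ν => a y ν - b y ν) y μ ν = dC a y μ ν - dC b y μ ν := by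
  simp only [dC]; abel

/-- **THE FLUX IDENTITY AT THE COCHAIN LEVEL**: the corner pullback of `F` (the flux of the slice pullback) plus the
coboundary of the neutralised Whitney potential is the fine flux cochain:
`cornerPull F + dC (neutralize (whitneyPot F)) = fineFlux F` (`μ ≠ ν`). [folklore] -/
theorem cornerPull_add_dC_neutralize {L : ℕ} (hL : 1 ≤ L) {F : Site d → Fin d → Fin d → 𝔸} (ha : Anti2 F)
    (hc : Closed2 F) (y : Site d) {μ ν : Fin d} (hμν : μ ≠ ν) :
    cornerPull L F y μ ν + dC (neutralize L (whitneyPot L F)) y μ ν = fineFlux L F y μ ν := by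
  unfold neutralize fineFlux
  rw [dC_sub, dC_whitneyPot hL ha hc y hμν, dC_sliceLift hL _ y hμν]
  abel

/-- **SIZE of the fine flux**: `‖fineFlux F (y; μ, ν)‖ ≤ M/L² + d·δ`. [folklore] -/
theorem norm_fineFlux_le {L : ℕ} (hL : 1 ≤ L) {F : Site d → Fin d → Fin d → 𝔸} (ha : Anti2 F) (hc : Closed2 F)
    {M δ : ℝ} (hM : ∀ z μ ν, ‖F z μ ν‖ ≤ M) (hδ0 : 0 ≤ δ)
    (hδ : ∀ (x : Site d) (α μ ν : Fin d), ‖F (x + e α) μ ν - F x μ ν‖ ≤ δ) (y : Site d) {μ ν : Fin d} (hμν : μ ≠ ν) :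
    ‖fineFlux L F y μ ν‖ ≤ M / (L : ℝ) ^ 2 + d * δ := by
  unfold fineFlux
  refine (norm_sub_le _ _).trans (add_le_add (norm_whitney_le hL F hM y μ ν) ?_)
  exact (norm_cornerPull_le L _ y μ ν).trans (norm_dC_Tcoarse_whitneyPot_le hL ha hc hδ0 hδ _ hμν)

/-- **SMOOTHNESS of the fine flux**: `‖fineFlux F (y + e_α; μ, ν) − fineFlux F (y; μ, ν)‖ ≤ δ/L² + 2d·δ`. [folklore] -/
theorem norm_fineFlux_fd_le {L : ℕ} (hL : 1 ≤ L) {F : Site d → Fin d → Fin d → 𝔸} (ha : Anti2 F) (hc : Closed2 F)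
    {δ : ℝ} (hδ0 : 0 ≤ δ) (hδ : ∀ (x : Site d) (α μ ν : Fin d), ‖F (x + e α) μ ν - F x μ ν‖ ≤ δ)
    (y : Site d) (α : Fin d) {μ ν : Fin d} (hμν : μ ≠ ν) :
    ‖fineFlux L F (y + e α) μ ν - fineFlux L F y μ ν‖ ≤ δ / (L : ℝ) ^ 2 + 2 * d * δ := by
  unfold fineFlux
  rw [show ∀ a b c e : 𝔸, a - b - (c - e) = (a - c) - (b - e) from fun a b c e => by abel]
  refine (norm_sub_le _ _).trans (add_le_add ?_ ?_)
  · -- the Whitney part: the difference formula of the interpolation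
    rw [whitney, whitney, ← smul_sub, interp_fd hL, norm_smul, norm_smul, Real.norm_of_nonneg (by positivity),
      Real.norm_eq_abs]
    have h1 : ‖interp L (((Finset.univ.erase μ).erase ν).erase α) (cfd α fun z => F z μ ν) y‖ ≤ δ :=
      norm_interp_le hL _ _ (fun x => hδ x α μ ν) y
    have h2 := abs_dcoef_le_one hL ((Finset.univ.erase μ).erase ν) y α
    calc 1 / (L : ℝ) ^ 2 * (|dcoef L ((Finset.univ.erase μ).erase ν) y α|
          * ‖interp L (((Finset.univ.erase μ).erase ν).erase α) (cfd α fun z => F z μ ν) y‖)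
        ≤ 1 / (L : ℝ) ^ 2 * (1 * δ) :=
          mul_le_mul_of_nonneg_left (mul_le_mul h2 h1 (norm_nonneg _) zero_le_one) (by positivity)
      _ = δ / (L : ℝ) ^ 2 := by ring
  · refine (norm_sub_le _ _).trans ?_
    have h := fun w => (norm_cornerPull_le L (fun z μ ν => dC (Tcoarse L (whitneyPot L F)) z μ ν) w μ ν).trans
      (norm_dC_Tcoarse_whitneyPot_le hL ha hc hδ0 hδ (blk L w) hμν)
    calc _ ≤ d * δ + d * δ := add_le_add (h _) (h _)
      _ = 2 * d * δ := by ring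

end Flux

end

end Summit.QuantumFields.BalabanUV.T4Continuum.SmoothRefineSquares
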